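import Summits.CriticalPhenomena.PercolationContinuityZ3.Theorems.PercNearOneGluingNoHeavyLowerTailNineTypeParity

/-!
# Nine-type oriented-antipodal programme for `Q44b`: the base case for the free types 5, 7

Support file for crux `stmt-CriticalPhenomena-4575` (master-family programme, quadratic four-point row `Q44b`),
seat `prim-bnk-1` gen 17; memo `run/shared/lean/prim/prim-l12/FROM-prim-bnk-1-gen17-NINE-TYPE-ANCHOR.md` §7.

In the abstract typed configurations of the OTA programme (see the anchor file
`…NineTypeAnchor.lean`) the anchor lemma settles all bad points of types `1,2,3,4,6,8,9`
("anchored", row `v_a = 1_{𝔊 ∩ ↑a}`).  For a bad point `t` of one of the two remaining types `5, 7`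
both rows `v_t = 1_{𝔊∩↑t}` and `w_t = 1_{𝔊∩↑tᶜ}` are available, and the rank programme needs that at
least one of them is independent of the anchored rows.  In GF(2) terms a dependency `v_t = Σ_{a∈A} v_a`
(`A ⊆ N` anchored) says: for every good `g`, `#{a ∈ A : a ⊆ g}` is odd iff `t ⊆ g`; likewise
`w_t = Σ_{b∈B} v_b` says `#{b ∈ B : b ⊆ g}` is odd iff `tᶜ ⊆ g`.

**Theorem (`NineType.base_false`).**  Both dependencies cannot exist simultaneously.  The hypotheses are
the cell-algebra facts for a point `t` of type 5/7 among anchored points `N` with `E ⊆ N` the points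
of types 8, 9: `a ∪ tᶜ` is good for `a ∈ N \ E` (HL), `b ∪ t` and `b ∪ b'ᶜ` are good for `b ∈ E`,
`b' ∈ N` (HH, HL), no anchored point contains `t` and no anchored point contains `tᶜ` (CONT, COV), a
subset of a type-8/9 point lying in `N` has type 8/9 (CONT), and the goods form an up-set.

**Proof (three parity counts, memo §7).**  (1) Summing the `A`-relation over the goods containing `tᶜ`
gives `Σ_{a∈A} κ(a ∪ tᶜ) ≡ 1` with `κ(u) = #{g ∈ 𝔊 : u ⊆ g}`; supersets of a good proper subset come
in pairs (toggle a missing element), so some `a₀ ∈ A ∩ E` has `a₀ ∪ tᶜ ∉ 𝔊`.  (2) `B ∩ E = ∅`: for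
`b₁ ∈ B ∩ E` of minimal size, the `B`-relation at the goods `b₁ ∪ t` and `b₁ ∪ b'ᶜ` (`b' ∈ B`) and the
symmetry of `(b,b') ↦ [b ∩ b' ⊆ b₁]` show that `#{b ∈ B : b ⊆ b₁}` is even, producing a smaller
`b₂ ∈ B ∩ E`.  (3) The `B`-relation at the goods `univ \ (b' ∩ (t \ a₀)) ⊇ a₀ ∪ b'ᶜ` and the symmetry of
`(b,b') ↦ [b ∩ b' ∩ (t \ a₀) = ∅]` give some `b ∈ B` inside `a₀ ∪ tᶜ`; by (2) `b ∪ tᶜ` is good, so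
`a₀ ∪ tᶜ` is good — contradicting (1).

Parity tools: `…NineTypeParity.lean`.  Pure finite combinatorics; no named facts, no sorries, standard axioms.
-/

namespace Summit.CriticalPhenomena.PercolationContinuityZ3.Theorems

namespace NineType

open Finset

variable {α : Type*} [DecidableEq α]

variable [Fintype α]

/-- **Base case of the free types (Theorem B of the memo).**  Let `N` be the anchored bad points, `E ⊆ N`
those of types 8, 9, `t` a bad point of type 5 or 7 and `𝔊` the up-set of goods, satisfying the
cell-algebra facts listed in the module docstring.  Then there are no `A, B ⊆ N` with
`#{a ∈ A : a ⊆ g}` odd `↔ t ⊆ g` and `#{b ∈ B : b ⊆ g}` odd `↔ tᶜ ⊆ g` for all goods `g`; i.e. the rows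
`v_t` and `w_t` are not both in the GF(2)-span of the anchored rows.  [this work, memo §7] -/
theorem base_false (N E : Finset (Finset α)) (t : Finset α)
    (𝔊 : Finset (Finset α)) (hG : ∀ g ∈ 𝔊, ∀ g' : Finset α, g ⊆ g' → g' ∈ 𝔊)
    (huniv : (Finset.univ : Finset α) ∈ 𝔊)
    (h1 : ∀ a ∈ N, a ∉ E → a ∪ tᶜ ∈ 𝔊)
    (h2 : ∀ b ∈ E, b ∪ t ∈ 𝔊)
    (h3 : ∀ b ∈ E, ∀ b' ∈ N, b ∪ b'ᶜ ∈ 𝔊)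
    (hc1 : ∀ a ∈ N, ¬ t ⊆ a)
    (hc2 : ∀ b ∈ E, ∀ b' ∈ N, b' ⊆ b → b' ∈ E)
    (hcov : ∀ b ∈ N, ¬ tᶜ ⊆ b)
    (A B : Finset (Finset α)) (hA : A ⊆ N) (hB : B ⊆ N)
    (hV : ∀ g ∈ 𝔊, ((#(A.filter (fun a => a ⊆ g)) : ℕ) : ZMod 2) = if t ⊆ g then 1 else 0)
    (hW : ∀ g ∈ 𝔊, ((#(B.filter (fun b => b ⊆ g)) : ℕ) : ZMod 2) = if tᶜ ⊆ g then 1 else 0) :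
    False := by
  -- κ(u) = number of goods above `u`, mod 2
  set κ : Finset α → ZMod 2 := fun u => ((#(𝔊.filter (fun g => u ⊆ g)) : ℕ) : ZMod 2) with hκ
  -- goods strictly above a good proper set come in pairs
  have κ_good : ∀ u : Finset α, u ∈ 𝔊 → (∃ x, x ∉ u) → κ u = 0 := by
    intro u hu ⟨x, hx⟩
    exact card_supersets_even 𝔊 hG u hu x hx
  ------------------------------------------------------------------
  -- Step 1: some `a₀ ∈ A ∩ E` has `a₀ ∪ tᶜ ∉ 𝔊`.
  ------------------------------------------------------------------
  have step1 : ∃ a₀ ∈ A, a₀ ∈ E ∧ a₀ ∪ tᶜ ∉ 𝔊 := by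
    -- double count S = Σ_{g ∈ 𝔊, tᶜ ⊆ g} #{a ∈ A : a ⊆ g}
    set 𝔊t := 𝔊.filter (fun g => tᶜ ⊆ g) with h𝔊t
    have hS1 : ∑ g ∈ 𝔊t, ((#(A.filter (fun a => a ⊆ g)) : ℕ) : ZMod 2) = 1 := by
      have hval : ∀ g ∈ 𝔊t, ((#(A.filter (fun a => a ⊆ g)) : ℕ) : ZMod 2)
          = if g = Finset.univ then 1 else 0 := by
        intro g hg
        rcases Finset.mem_filter.1 hg with ⟨hgG, htc⟩
        rw [hV g hgG]
        by_cases htg : t ⊆ g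
        · have hgu : g = Finset.univ := by
            apply Finset.eq_univ_of_forall
            intro y
            by_cases hy : y ∈ t
            · exact htg hy
            · exact htc (Finset.mem_compl.2 hy)
          rw [if_pos htg, if_pos hgu]
        · have hgu : g ≠ Finset.univ := by
            intro h
            exact htg (h ▸ Finset.subset_univ t)
          rw [if_neg htg, if_neg hgu]
      rw [Finset.sum_congr rfl hval, Finset.sum_ite_eq' 𝔊t Finset.univ (fun _ => (1 : ZMod 2))]
      have hu : (Finset.univ : Finset α) ∈ 𝔊t :=
        Finset.mem_filter.2 ⟨huniv, Finset.subset_univ _⟩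
      simp [hu]
    have hS2 : ∑ g ∈ 𝔊t, ((#(A.filter (fun a => a ⊆ g)) : ℕ) : ZMod 2)
        = ∑ a ∈ A, κ (a ∪ tᶜ) := by
      have : ∀ g ∈ 𝔊t, ((#(A.filter (fun a => a ⊆ g)) : ℕ) : ZMod 2)
          = ∑ a ∈ A, (if a ⊆ g then (1 : ZMod 2) else 0) :=
        fun g _ => card_filter_cast A (fun a => a ⊆ g)
      rw [Finset.sum_congr rfl this, Finset.sum_comm]
      refine Finset.sum_congr rfl ?_
      intro a _
      rw [hκ]
      simp only
      rw [card_filter_cast, h𝔊t, Finset.sum_filter]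
      refine Finset.sum_congr rfl ?_
      intro g _
      by_cases h : a ∪ tᶜ ⊆ g
      · have h' : tᶜ ⊆ g := (Finset.subset_union_right).trans h
        have h'' : a ⊆ g := (Finset.subset_union_left).trans h
        simp [h, h', h'']
      · by_cases h' : tᶜ ⊆ g
        · have h'' : ¬ a ⊆ g := fun ha => h (Finset.union_subset ha h')
          simp [h, h', h'']
        · simp [h, h']
    -- terms with a ∉ E vanish
    have hvan : ∀ a ∈ A, a ∉ E → κ (a ∪ tᶜ) = 0 := by
      intro a ha haE
      obtain ⟨x, hx⟩ : ∃ x, x ∈ t ∧ x ∉ a := by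
        by_contra hcon
        exact hc1 a (hA ha) (fun y hy => by
          by_contra hy'
          exact hcon ⟨y, hy, hy'⟩)
      refine κ_good (a ∪ tᶜ) (h1 a (hA ha) haE) ⟨x, ?_⟩
      intro hmem
      rcases Finset.mem_union.1 hmem with h | h
      · exact hx.2 h
      · exact (Finset.mem_compl.1 h) hx.1
    have hsum : ∑ a ∈ A, κ (a ∪ tᶜ) = 1 := by rw [← hS2, hS1]
    have hne : ∑ a ∈ A, κ (a ∪ tᶜ) ≠ 0 := by rw [hsum]; decide
    obtain ⟨a₀, ha₀, hκa₀⟩ := Finset.exists_ne_zero_of_sum_ne_zero hne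
    have ha₀E : a₀ ∈ E := by
      by_contra h
      exact hκa₀ (hvan a₀ ha₀ h)
    refine ⟨a₀, ha₀, ha₀E, ?_⟩
    intro hgood
    obtain ⟨x, hx⟩ : ∃ x, x ∈ t ∧ x ∉ a₀ := by
      by_contra hcon
      exact hc1 a₀ (hA ha₀) (fun y hy => by
        by_contra hy'
        exact hcon ⟨y, hy, hy'⟩)
    refine hκa₀ (κ_good (a₀ ∪ tᶜ) hgood ⟨x, ?_⟩)
    intro hmem
    rcases Finset.mem_union.1 hmem with h | h
    · exact hx.2 h
    · exact (Finset.mem_compl.1 h) hx.1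
  ------------------------------------------------------------------
  -- Step 2: `B ∩ E = ∅`.
  ------------------------------------------------------------------
  have step2 : ∀ b ∈ B, b ∉ E := by
    intro b₀ hb₀ hb₀E
    have hne : (B.filter (fun b => b ∈ E)).Nonempty := ⟨b₀, Finset.mem_filter.2 ⟨hb₀, hb₀E⟩⟩
    obtain ⟨b₁, hb₁, hmin⟩ := Finset.exists_min_image (B.filter (fun b => b ∈ E)) card hne
    rcases Finset.mem_filter.1 hb₁ with ⟨hb₁B, hb₁E⟩
    -- E1: #{b ∈ B : b ⊆ b₁ ∪ t} is even
    have hE1 : ((#(B.filter (fun b => b ⊆ b₁ ∪ t)) : ℕ) : ZMod 2) = 0 := by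
      rw [hW (b₁ ∪ t) (h2 b₁ hb₁E)]
      have : ¬ tᶜ ⊆ b₁ ∪ t := by
        intro h
        apply hcov b₁ (hB hb₁B)
        intro y hy
        rcases Finset.mem_union.1 (h hy) with h' | h'
        · exact h'
        · exact absurd h' (Finset.mem_compl.1 hy)
      simp [this]
    -- E2: for b' ∈ B, #{b ∈ B : b ∩ b' ⊆ b₁} ≡ [b' ⊆ b₁ ∪ t]
    have hE2 : ∀ b' ∈ B, ((#(B.filter (fun b => b ∩ b' ⊆ b₁)) : ℕ) : ZMod 2)
        = if b' ⊆ b₁ ∪ t then 1 else 0 := by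
      intro b' hb'
      have hg : b₁ ∪ b'ᶜ ∈ 𝔊 := h3 b₁ hb₁E b' (hB hb')
      have hfilt : B.filter (fun b => b ∩ b' ⊆ b₁) = B.filter (fun b => b ⊆ b₁ ∪ b'ᶜ) := by
        refine Finset.filter_congr ?_
        intro b _
        constructor
        · intro h y hy
          by_cases hyb' : y ∈ b'
          · exact Finset.mem_union_left _ (h (Finset.mem_inter.2 ⟨hy, hyb'⟩))
          · exact Finset.mem_union_right _ (Finset.mem_compl.2 hyb')
        · intro h y hy
          rcases Finset.mem_inter.1 hy with ⟨hyb, hyb'⟩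
          rcases Finset.mem_union.1 (h hyb) with h' | h'
          · exact h'
          · exact absurd hyb' (Finset.mem_compl.1 h')
      rw [hfilt, hW _ hg]
      have hiff : tᶜ ⊆ b₁ ∪ b'ᶜ ↔ b' ⊆ b₁ ∪ t := by
        constructor
        · intro h y hy
          by_cases hyt : y ∈ t
          · exact Finset.mem_union_right _ hyt
          · rcases Finset.mem_union.1 (h (Finset.mem_compl.2 hyt)) with h' | h'
            · exact Finset.mem_union_left _ h'
            · exact absurd hy (Finset.mem_compl.1 h')
        · intro h y hy
          by_cases hyb' : y ∈ b'
          · rcases Finset.mem_union.1 (h hyb') with h' | h'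
            · exact Finset.mem_union_left _ h'
            · exact absurd h' (Finset.mem_compl.1 hy)
          · exact Finset.mem_union_right _ (Finset.mem_compl.2 hyb')
      by_cases h : b' ⊆ b₁ ∪ t
      · simp [h, hiff.2 h]
      · have : ¬ tᶜ ⊆ b₁ ∪ b'ᶜ := fun h' => h (hiff.1 h')
        simp [h, this]
    -- symmetric double counting
    have hsym := sum_card_filter_symm B (fun b b' => b ∩ b' ⊆ b₁)
      (fun b _ b' _ h => by rw [Finset.inter_comm]; exact h)
    have hlhs : (∑ b' ∈ B, ((#(B.filter (fun b => b ∩ b' ⊆ b₁)) : ℕ) : ZMod 2)) = 0 := by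
      rw [Finset.sum_congr rfl hE2, ← card_filter_cast, hE1]
    have hdiag : ((#(B.filter (fun b => b ∩ b ⊆ b₁)) : ℕ) : ZMod 2) = 0 := by
      rw [← hsym, hlhs]
    have hfilt : B.filter (fun b => b ∩ b ⊆ b₁) = B.filter (fun b => b ⊆ b₁) := by
      refine Finset.filter_congr ?_
      intro b _
      rw [Finset.inter_self]
    rw [hfilt] at hdiag
    -- the even set `{b ∈ B : b ⊆ b₁}` contains `b₁`, hence another, strictly smaller, member
    have heven : Even #(B.filter (fun b => b ⊆ b₁)) := (ZMod.natCast_eq_zero_iff_even).1 hdiag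
    have hb₁in : b₁ ∈ B.filter (fun b => b ⊆ b₁) := Finset.mem_filter.2 ⟨hb₁B, subset_rfl⟩
    have hcard2 : 2 ≤ #(B.filter (fun b => b ⊆ b₁)) := by
      have hpos : 0 < #(B.filter (fun b => b ⊆ b₁)) := Finset.card_pos.2 ⟨b₁, hb₁in⟩
      obtain ⟨k, hk⟩ := heven
      omega
    obtain ⟨b₂, hb₂, hne⟩ := Finset.exists_mem_ne hcard2 b₁
    rcases Finset.mem_filter.1 hb₂ with ⟨hb₂B, hb₂sub⟩
    have hb₂E : b₂ ∈ E := hc2 b₁ hb₁E b₂ (hB hb₂B) hb₂sub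
    have hlt : #b₂ < #b₁ := Finset.card_lt_card (lt_of_le_of_ne hb₂sub hne)
    have hge : #b₁ ≤ #b₂ := hmin b₂ (Finset.mem_filter.2 ⟨hb₂B, hb₂E⟩)
    omega
  ------------------------------------------------------------------
  -- Step 3: some `b ∈ B` lies inside `a₀ ∪ tᶜ`, which forces `a₀ ∪ tᶜ ∈ 𝔊`.
  ------------------------------------------------------------------
  obtain ⟨a₀, ha₀A, ha₀E, ha₀bad⟩ := step1
  set Q : Finset α := t \ a₀ with hQ
  -- the goods h_{b'} = univ \ (b' ∩ Q)
  have hE3 : ∀ b' ∈ B, ((#(B.filter (fun b => Disjoint (b ∩ b') Q)) : ℕ) : ZMod 2) = 1 := by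
    intro b' hb'
    set h : Finset α := (b' ∩ Q)ᶜ with hh
    have hsub : a₀ ∪ b'ᶜ ⊆ h := by
      intro y hy
      rw [hh, Finset.mem_compl, Finset.mem_inter]
      rintro ⟨hyb', hyQ⟩
      rcases Finset.mem_union.1 hy with h' | h'
      · exact (Finset.mem_sdiff.1 hyQ).2 h'
      · exact (Finset.mem_compl.1 h') hyb'
    have hgood : h ∈ 𝔊 := hG _ (h3 a₀ ha₀E b' (hB hb')) h hsub
    have htc : tᶜ ⊆ h := by
      intro y hy
      rw [hh, Finset.mem_compl, Finset.mem_inter]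
      rintro ⟨_, hyQ⟩
      exact (Finset.mem_compl.1 hy) (Finset.mem_sdiff.1 hyQ).1
    have hfilt : B.filter (fun b => Disjoint (b ∩ b') Q) = B.filter (fun b => b ⊆ h) := by
      refine Finset.filter_congr ?_
      intro b _
      rw [hh]
      constructor
      · intro hd y hy
        rw [Finset.mem_compl, Finset.mem_inter]
        rintro ⟨hyb', hyQ⟩
        exact Finset.disjoint_left.1 hd (Finset.mem_inter.2 ⟨hy, hyb'⟩) hyQ
      · intro hs
        rw [Finset.disjoint_left]
        intro y hy hyQ
        rcases Finset.mem_inter.1 hy with ⟨hyb, hyb'⟩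
        have := hs hyb
        rw [Finset.mem_compl, Finset.mem_inter] at this
        exact this ⟨hyb', hyQ⟩
    rw [hfilt, hW h hgood]
    simp [htc]
  have hsym := sum_card_filter_symm B (fun b b' => Disjoint (b ∩ b') Q)
    (fun b _ b' _ h => by rw [Finset.inter_comm]; exact h)
  have hlhs : (∑ b' ∈ B, ((#(B.filter (fun b => Disjoint (b ∩ b') Q)) : ℕ) : ZMod 2))
      = ((#B : ℕ) : ZMod 2) := by
    rw [Finset.sum_congr rfl hE3]
    simp
  have hBodd : ((#B : ℕ) : ZMod 2) = 1 := by
    have := hW Finset.univ huniv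
    have hfilt : B.filter (fun b => b ⊆ Finset.univ) = B :=
      Finset.filter_true_of_mem (fun b _ => Finset.subset_univ b)
    rw [hfilt] at this
    simpa using this
  have hdiag : ((#(B.filter (fun b => Disjoint (b ∩ b) Q)) : ℕ) : ZMod 2) = 1 := by
    rw [← hsym, hlhs, hBodd]
  have hne : #(B.filter (fun b => Disjoint (b ∩ b) Q)) ≠ 0 := by
    intro h0
    rw [h0, Nat.cast_zero] at hdiag
    exact zero_ne_one hdiag
  obtain ⟨b, hb⟩ := Finset.card_pos.1 (Nat.pos_of_ne_zero hne)
  rcases Finset.mem_filter.1 hb with ⟨hbB, hbQ⟩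
  rw [Finset.inter_self] at hbQ
  -- b ⊆ a₀ ∪ tᶜ, and b ∪ tᶜ is good
  have hbsub : b ∪ tᶜ ⊆ a₀ ∪ tᶜ := by
    intro y hy
    rcases Finset.mem_union.1 hy with h' | h'
    · by_cases hyt : y ∈ t
      · by_cases hya : y ∈ a₀
        · exact Finset.mem_union_left _ hya
        · exfalso
          exact Finset.disjoint_left.1 hbQ h' (Finset.mem_sdiff.2 ⟨hyt, hya⟩)
      · exact Finset.mem_union_right _ (Finset.mem_compl.2 hyt)
    · exact Finset.mem_union_right _ h'
  have hbgood : b ∪ tᶜ ∈ 𝔊 := h1 b (hB hbB) (step2 b hbB)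
  exact ha₀bad (hG _ hbgood _ hbsub)

/-- **Base case, odd-target form.**  Under the hypotheses of `anchor_exists_odd_target` for the anchored
points `N` and of `base_false` for the free point `t` (with `t, tᶜ ∉ N`), one of the two representatives
`ρ ∈ {t, tᶜ}` can be added to `N` keeping the odd-target property: every nonempty `𝒮 ⊆ insert ρ N` has
a good `g` containing an odd number of its members (the rows of `N` together with `v_t` or with `w_t`
are GF(2)-independent).  [this work, memo §7] -/
theorem base_exists_rep (N E : Finset (Finset α)) (θ : Finset α → ℕ)
    (hθ : ∀ a ∈ N, θ a ∈ anchorTypes)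
    (hcont : ∀ s ∈ N, ∀ s' ∈ N, s ⊆ s' → (θ s, θ s') ∈ contPairs)
    (𝔊 : Finset (Finset α)) (hGup : IsUpperSet (𝔊 : Set (Finset α)))
    (hHL : ∀ a ∈ N, ∀ a' ∈ N, hlOK (θ a) (θ a') = true → a ∪ a'ᶜ ∈ 𝔊)
    (t : Finset α) (htN : t ∉ N) (htcN : tᶜ ∉ N)
    (huniv : (Finset.univ : Finset α) ∈ 𝔊)
    (h1 : ∀ a ∈ N, a ∉ E → a ∪ tᶜ ∈ 𝔊)
    (h2 : ∀ b ∈ E, b ∪ t ∈ 𝔊)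
    (h3 : ∀ b ∈ E, ∀ b' ∈ N, b ∪ b'ᶜ ∈ 𝔊)
    (hc1 : ∀ a ∈ N, ¬ t ⊆ a)
    (hc2 : ∀ b ∈ E, ∀ b' ∈ N, b' ⊆ b → b' ∈ E)
    (hcov : ∀ b ∈ N, ¬ tᶜ ⊆ b) :
    ∃ ρ ∈ ({t, tᶜ} : Finset (Finset α)), ∀ 𝒮 ⊆ insert ρ N, 𝒮.Nonempty →
      ∃ g ∈ 𝔊, Odd #(𝒮.filter (fun S => S ⊆ g)) := by
  have hG : ∀ g ∈ 𝔊, ∀ g' : Finset α, g ⊆ g' → g' ∈ 𝔊 :=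
    fun g hg g' hgg' => hGup hgg' hg
  -- if a family `𝒮 ⊆ insert ρ N` has no odd target, it contains `ρ` and yields a parity relation
  have extract : ∀ ρ : Finset α, ρ ∉ N → ∀ 𝒮 ⊆ insert ρ N, 𝒮.Nonempty →
      (∀ g ∈ 𝔊, ¬ Odd #(𝒮.filter (fun S => S ⊆ g))) →
      ∃ A ⊆ N, ∀ g ∈ 𝔊, ((#(A.filter (fun a => a ⊆ g)) : ℕ) : ZMod 2) = if ρ ⊆ g then 1 else 0 := by
    intro ρ hρN 𝒮 h𝒮 hne hno
    by_cases hρ𝒮 : ρ ∈ 𝒮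
    · refine ⟨𝒮.erase ρ, ?_, ?_⟩
      · intro a ha
        rcases Finset.mem_insert.1 (h𝒮 (Finset.mem_of_mem_erase ha)) with h | h
        · exact absurd h (Finset.ne_of_mem_erase ha)
        · exact h
      · have hins : insert ρ (𝒮.erase ρ) = 𝒮 := Finset.insert_erase hρ𝒮
        have := parity_of_no_odd_target (𝒮.erase ρ) ρ (Finset.notMem_erase ρ 𝒮) 𝔊
        rw [hins] at this
        exact this hno
    · exfalso
      have h𝒮N : 𝒮 ⊆ N := by
        intro a ha
        rcases Finset.mem_insert.1 (h𝒮 ha) with h | h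
        · exact absurd (h ▸ ha) hρ𝒮
        · exact h
      obtain ⟨g, hg, hodd⟩ := anchor_exists_odd_target N θ hθ hcont 𝔊 hGup hHL 𝒮 h𝒮N hne
      exact hno g hg hodd
  by_cases ht : ∀ 𝒮 ⊆ insert t N, 𝒮.Nonempty → ∃ g ∈ 𝔊, Odd #(𝒮.filter (fun S => S ⊆ g))
  · exact ⟨t, by simp, ht⟩
  by_cases htc : ∀ 𝒮 ⊆ insert tᶜ N, 𝒮.Nonempty → ∃ g ∈ 𝔊, Odd #(𝒮.filter (fun S => S ⊆ g))
  · exact ⟨tᶜ, by simp, htc⟩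
  exfalso
  push Not at ht htc
  obtain ⟨𝒮₁, h𝒮₁, hne₁, hno₁⟩ := ht
  obtain ⟨𝒮₂, h𝒮₂, hne₂, hno₂⟩ := htc
  obtain ⟨A, hA, hV⟩ := extract t htN 𝒮₁ h𝒮₁ hne₁ (fun g hg => hno₁ g hg)
  obtain ⟨B, hB, hW⟩ := extract tᶜ htcN 𝒮₂ h𝒮₂ hne₂ (fun g hg => hno₂ g hg)
  exact base_false N E t 𝔊 hG huniv h1 h2 h3 hc1 hc2 hcov A B hA hB hV hW

/-- **Base case, counting form**: under the same hypotheses `#N + 1 ≤ #𝔊` (the anchored points plus one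
point of type 5 or 7 are outnumbered by the goods).  [this work] -/
theorem base_card_le (N E : Finset (Finset α)) (θ : Finset α → ℕ)
    (hθ : ∀ a ∈ N, θ a ∈ anchorTypes)
    (hcont : ∀ s ∈ N, ∀ s' ∈ N, s ⊆ s' → (θ s, θ s') ∈ contPairs)
    (𝔊 : Finset (Finset α)) (hGup : IsUpperSet (𝔊 : Set (Finset α)))
    (hHL : ∀ a ∈ N, ∀ a' ∈ N, hlOK (θ a) (θ a') = true → a ∪ a'ᶜ ∈ 𝔊)
    (t : Finset α) (htN : t ∉ N) (htcN : tᶜ ∉ N)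
    (huniv : (Finset.univ : Finset α) ∈ 𝔊)
    (h1 : ∀ a ∈ N, a ∉ E → a ∪ tᶜ ∈ 𝔊)
    (h2 : ∀ b ∈ E, b ∪ t ∈ 𝔊)
    (h3 : ∀ b ∈ E, ∀ b' ∈ N, b ∪ b'ᶜ ∈ 𝔊)
    (hc1 : ∀ a ∈ N, ¬ t ⊆ a)
    (hc2 : ∀ b ∈ E, ∀ b' ∈ N, b' ⊆ b → b' ∈ E)
    (hcov : ∀ b ∈ N, ¬ tᶜ ⊆ b) : #N + 1 ≤ #𝔊 := by
  obtain ⟨ρ, hρ, hodd⟩ :=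
    base_exists_rep N E θ hθ hcont 𝔊 hGup hHL t htN htcN huniv h1 h2 h3 hc1 hc2 hcov
  have hρN : ρ ∉ N := by
    rcases Finset.mem_insert.1 hρ with h | h
    · exact h ▸ htN
    · rw [Finset.mem_singleton] at h
      exact h ▸ htcN
  have hcard : #(insert ρ N) = #N + 1 := Finset.card_insert_of_notMem hρN
  rw [← hcard]
  exact card_le_card_of_odd_targets (insert ρ N) 𝔊 hodd

end NineType

end Summit.CriticalPhenomena.PercolationContinuityZ3.Theorems
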